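import Literature.NumberTheory.LFunctions.RichertBoundsFromExpSum
import HarnessLib

/-!
# The small-`λ` range of the zeta-sum estimate: shifted power savings from van der Corput's method,
# and the reduction of `ExpSumBound` to Vinogradov's range

Topic `Literature/NumberTheory/LFunctions`.  Everything in this file is PROVED; no named fact is
introduced (one parametrised hypothesis, `VinogradovRangeBound K C c`, is defined).

`RichertBoundsFromExpSum.lean` reduces the Vinogradov–Korobov zero-free region (and with it the
twisted prime number theorem, Matomäki–Radziwiłł–Tao (1.12), Lichtman's Lemma 4.5) to
`ExpSumBound C D`: `‖∑_{N < n ≤ R}(n + u)^{-it}‖ ≤ C N^{1 − (log N)²/(D log² t)}` for ALL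
`1 ≤ N ≤ t` (`N < R ≤ 2N`, `0 < u ≤ 1`) — Ford's Theorem 2.  Vinogradov's method proper only treats
`λ = log t/log N` large (Titchmarsh §6.19: `k ≥ 19`; Ford §5: `λ ≥ 87`), the range of bounded `λ`
being van der Corput's / Weyl's (Ford §6).  Here:

* `VdC.powerSaving_shift` — for every `K ≥ 1` there are `C, δ > 0` with
  `‖∑_{N < n ≤ x} (n + w)^{-iu}‖ ≤ C N^{1−δ}` for `1 ≤ N < x ≤ 2N`, `√N ≤ u ≤ N^{K + 1/2}`,
  `0 ≤ w ≤ 1`: the tree's `VdC.powerSaving` (all `k`-th derivative tests `2 ≤ k ≤ K + 1`,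
  `VdC.kth_deriv_test`) run for the translated phase `−(u/2π) log(y + w)`
  (`phaseD_derivFamily_shift`, `phaseD_bound_shift`: on `[N, 2N]`, `N ≤ y + w ≤ 3N`, so `h = 3^k`);
* `expSumBound_of_vinogradovRange` — **`VinogradovRangeBound K C c ⟹ ∃ C' D, ExpSumBound C' D`**,
  where `VinogradovRangeBound K C c` asks for `‖∑(n + u)^{-it}‖ ≤ C N^{1 − c(log N)²/(log t)²}` only
  when `N^{K + 1/2} ≤ t` (`λ ≥ K + 1/2`); for `N^{K+1/2} > t ≥ N` the power saving gives
  `N^{1−δ} ≤ N^{1 − (log N)²/(D log²t)}` with `D = max(1/δ, 1/c)` since `log N ≤ log t`;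
* `hasVKZeroFreeRegion_of_vinogradovRange` — the zero-free region from `VinogradovRangeBound` alone.

So the remaining input of the whole chain is Vinogradov's estimate in its natural range, i.e.
Vinogradov's mean value theorem and its standard consequence for `f(x) = −(t/2π) log(x + u)`
(Ford 2002, Theorems 3–4 and §5; Ivić, Ch. 6; Titchmarsh (6.19.1)).

## References

* K. Ford, *Vinogradov's integral and bounds for the Riemann zeta function*, Proc. LMS 85 (2002) =
  arXiv:1910.08209, Theorem 2, §§5–6. [Ford2002]
* S. W. Graham, G. Kolesnik, *Van der Corput's Method of Exponential Sums*, Thm 2.8 (`k`-th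
  derivative test), via the tree's `VdC.kth_deriv_test`. [GrahamKolesnik1991]
* E. C. Titchmarsh, *The Theory of the Riemann Zeta-Function*, 2nd ed., §6.19 (6.19.1). [Titchmarsh1986]
-/

noncomputable section

open Finset Real

namespace Literature.NumberTheory.LFunctions
namespace VdC

/-- The translated phase family `y ↦ D_j(y + w)` is again a derivative family. [folklore] -/
theorem phaseD_derivFamily_shift (u w : ℝ) {a b : ℝ} (ha : 0 < a + w) (k : ℕ) :
    DerivFamily (fun j y ↦ phaseD u j (y + w)) a b k := by
  intro j hj y hy
  have hfam := phaseD_derivFamily u (a := a + w) (b := b + w) ha k j hj (y + w)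
    ⟨by linarith [hy.1], by linarith [hy.2]⟩
  exact hfam.comp_add_const y w

/-- Size of the `k`-th derivative of the shifted phase on `[N, 2N]`, `0 ≤ w ≤ 1 ≤ N`: with
`λ = (u/2π)(k-1)!/(3N)^k`, `λ ≤ (-1)^k D_k(y + w) ≤ 3^k λ` (since `N ≤ y + w ≤ 3N`). [folklore] -/
theorem phaseD_bound_shift (u : ℝ) (hu : 0 < u) {N : ℝ} (hN : 1 ≤ N) {w : ℝ} (hw0 : 0 ≤ w)
    (hw1 : w ≤ 1) (j : ℕ) {y : ℝ} (hy : y ∈ Set.Icc N (2 * N)) :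
    u / (2 * π) * (Nat.factorial j : ℝ) / (3 * N) ^ (j + 1) ≤ (-1) ^ (j + 1) * phaseD u (j + 1) (y + w)
    ∧ (-1) ^ (j + 1) * phaseD u (j + 1) (y + w)
      ≤ (3 : ℝ) ^ (j + 1) * (u / (2 * π) * (Nat.factorial j : ℝ) / (3 * N) ^ (j + 1)) := by
  have hN0 : 0 < N := by linarith
  have hy0 : 0 < y + w := by linarith [hy.1]
  have hyup : y + w ≤ 3 * N := by linarith [hy.2]
  have hylow : N ≤ y + w := by linarith [hy.1]
  rw [phaseD_succ' u j (y + w)]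
  have hc : 0 < u / (2 * π) * (Nat.factorial j : ℝ) := by
    have := Nat.factorial_pos j; positivity
  constructor
  · apply div_le_div_of_nonneg_left hc.le (by positivity)
    exact pow_le_pow_left₀ hy0.le hyup _
  · rw [show (3 : ℝ) ^ (j + 1) * (u / (2 * π) * (Nat.factorial j : ℝ) / (3 * N) ^ (j + 1))
        = u / (2 * π) * (Nat.factorial j : ℝ) / N ^ (j + 1) by
      rw [mul_pow]; field_simp]
    apply div_le_div_of_nonneg_left hc.le (by positivity)
    exact pow_le_pow_left₀ hN0.le hylow _

/-- **Power saving for the shifted sums `∑_{N<n≤x} (n + w)^{-iu}`, `0 ≤ w ≤ 1`, in the range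
`N^{k-3/2} ≤ u ≤ N^{k-1/2}`** from the `k`-th derivative test (as `powerSaving_k`, with the
translated phase family and `h = 3^k`). [folklore] -/
theorem powerSaving_shift_k (k : ℕ) (hk : 2 ≤ k) :
    ∃ C δ : ℝ, 0 < δ ∧ 0 ≤ C ∧ ∀ N : ℕ, 1 ≤ N → ∀ u : ℝ,
      (N : ℝ) ^ ((k : ℝ) - 3 / 2) ≤ u → u ≤ (N : ℝ) ^ ((k : ℝ) - 1 / 2) →
      ∀ w : ℝ, 0 ≤ w → w ≤ 1 → ∀ x : ℕ, N < x → x ≤ 2 * N →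
        ‖∑ n ∈ Finset.Ioc (N : ℤ) x, e (phaseD u 0 ((n : ℝ) + w))‖ ≤ C * (N : ℝ) ^ (1 - δ) := by
  obtain ⟨j, rfl⟩ : ∃ j, k = j + 1 := ⟨k - 1, by omega⟩
  have hh : (1 : ℝ) ≤ (3 : ℝ) ^ (j + 1) := one_le_pow₀ (by norm_num)
  obtain ⟨C, α, β, hC, hα, hα1, hβ, hβ1, HK⟩ := kth_deriv_test hh (j + 1) hk
  set c : ℝ := (Nat.factorial j : ℝ) / (2 * π * 3 ^ (j + 1)) with hc
  have hc0 : 0 < c := by have := Nat.factorial_pos j; positivity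
  set δ : ℝ := min (α / 2) (β / 4) with hδ
  have hδ0 : 0 < δ := lt_min (by linarith) (by linarith)
  refine ⟨C * (c ^ α + c ^ (-(β / 2))), δ, hδ0, by positivity, ?_⟩
  intro N hN u hu1 hu2 w hw0 hw1 x hx1 hx2
  have hN0 : (0 : ℝ) < N := by exact_mod_cast hN
  have hN1 : (1 : ℝ) ≤ N := by exact_mod_cast hN
  have hu0 : 0 < u := by
    have : (1 : ℝ) ≤ (N : ℝ) ^ (((j + 1 : ℕ) : ℝ) - 3 / 2) := Real.one_le_rpow hN1 (by
      have : (2 : ℝ) ≤ (j + 1 : ℕ) := by exact_mod_cast hk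
      linarith)
    linarith
  -- λ and its range
  set lam : ℝ := u / (2 * π) * (Nat.factorial j : ℝ) / (3 * (N : ℝ)) ^ (j + 1) with hlam
  have hlam_eq : lam = c * (u * (N : ℝ) ^ (-((j : ℝ) + 1))) := by
    rw [hlam, hc, Real.rpow_neg hN0.le, show (j : ℝ) + 1 = ((j + 1 : ℕ) : ℝ) by push_cast; ring,
      Real.rpow_natCast, mul_pow]
    field_simp
  have hlam0 : 0 < lam := by rw [hlam_eq]; positivity
  have hjr : ((j + 1 : ℕ) : ℝ) = (j : ℝ) + 1 := by push_cast; ring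
  have hlam_up : lam ≤ c * (N : ℝ) ^ (-(1 / 2 : ℝ)) := by
    rw [hlam_eq]
    apply mul_le_mul_of_nonneg_left _ hc0.le
    calc u * (N : ℝ) ^ (-((j : ℝ) + 1)) ≤ (N : ℝ) ^ (((j + 1 : ℕ) : ℝ) - 1 / 2) * (N : ℝ) ^ (-((j : ℝ) + 1)) :=
          mul_le_mul_of_nonneg_right hu2 (by positivity)
      _ = (N : ℝ) ^ (-(1 / 2 : ℝ)) := by
          rw [← Real.rpow_add hN0, hjr]; congr 1; ring
  have hlam_low : c * (N : ℝ) ^ (-(3 / 2 : ℝ)) ≤ lam := by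
    rw [hlam_eq]
    apply mul_le_mul_of_nonneg_left _ hc0.le
    calc (N : ℝ) ^ (-(3 / 2 : ℝ)) = (N : ℝ) ^ (((j + 1 : ℕ) : ℝ) - 3 / 2) * (N : ℝ) ^ (-((j : ℝ) + 1)) := by
          rw [← Real.rpow_add hN0]; congr 1; push_cast; ring
      _ ≤ u * (N : ℝ) ^ (-((j : ℝ) + 1)) := mul_le_mul_of_nonneg_right hu1 (by positivity)
  -- the k-th derivative test for the translated family on `(N, x]`
  have hab : (N : ℤ) < x := by exact_mod_cast hx1
  have hfam : DerivFamily (fun i y ↦ phaseD u i (y + w)) ((N : ℤ) : ℝ) ((x : ℤ) : ℝ) (j + 1) :=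
    phaseD_derivFamily_shift u w (by push_cast; linarith) _
  have hbound : ∀ y ∈ Set.Icc (((N : ℤ) : ℝ)) ((x : ℤ) : ℝ),
      lam ≤ (-1) ^ (j + 1) * phaseD u (j + 1) (y + w) ∧
        (-1) ^ (j + 1) * phaseD u (j + 1) (y + w) ≤ 3 ^ (j + 1) * lam := by
    intro y hy
    have hy' : y ∈ Set.Icc (N : ℝ) (2 * N) := by
      push_cast at hy
      refine ⟨hy.1, hy.2.trans ?_⟩
      exact_mod_cast hx2
    exact phaseD_bound_shift u hu0 hN1 hw0 hw1 j hy'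
  have hε : ((-1 : ℝ) ^ (j + 1) = 1) ∨ ((-1 : ℝ) ^ (j + 1) = -1) := by
    rcases neg_one_pow_eq_or ℝ (j + 1) with h | h
    · exact Or.inl h
    · exact Or.inr h
  have hK := HK.signed (k := j + 1) (ε := (-1 : ℝ) ^ (j + 1)) hε hlam0 hab hfam hbound
  refine hK.trans ?_
  -- bookkeeping as in `powerSaving_k`
  have hL : ((x : ℤ) : ℝ) - ((N : ℤ) : ℝ) ≤ N := by
    push_cast
    have : (x : ℝ) ≤ 2 * N := by exact_mod_cast hx2
    linarith
  have hL1 : 1 ≤ ((x : ℤ) : ℝ) - ((N : ℤ) : ℝ) := by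
    push_cast
    have : (N : ℝ) + 1 ≤ x := by exact_mod_cast hx1
    linarith
  set L : ℝ := ((x : ℤ) : ℝ) - ((N : ℤ) : ℝ) with hLdef
  have hT1 : L * lam ^ α ≤ c ^ α * (N : ℝ) ^ (1 - δ) := by
    calc L * lam ^ α ≤ N * (c * (N : ℝ) ^ (-(1 / 2 : ℝ))) ^ α :=
          mul_le_mul hL (Real.rpow_le_rpow hlam0.le hlam_up hα.le) (by positivity) hN0.le
      _ = c ^ α * (N : ℝ) ^ (1 - α / 2) := by
          rw [Real.mul_rpow hc0.le (by positivity), ← Real.rpow_mul hN0.le,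
            Real.rpow_sub hN0, Real.rpow_one]
          have : -(1 / 2 : ℝ) * α = -(α / 2) := by ring
          rw [this, Real.rpow_neg hN0.le]
          field_simp
      _ ≤ c ^ α * (N : ℝ) ^ (1 - δ) := by
          apply mul_le_mul_of_nonneg_left _ (by positivity)
          apply Real.rpow_le_rpow_of_exponent_le hN1
          have : δ ≤ α / 2 := min_le_left _ _
          linarith
  have hT2 : L ^ (1 - β) * lam ^ (-(β / 2)) ≤ c ^ (-(β / 2)) * (N : ℝ) ^ (1 - δ) := by
    have h1 : L ^ (1 - β) ≤ (N : ℝ) ^ (1 - β) := Real.rpow_le_rpow (by linarith) hL (by linarith)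
    have h2 : lam ^ (-(β / 2)) ≤ (c * (N : ℝ) ^ (-(3 / 2 : ℝ))) ^ (-(β / 2)) :=
      Real.rpow_le_rpow_of_nonpos (by positivity) hlam_low (by linarith)
    calc L ^ (1 - β) * lam ^ (-(β / 2)) ≤ (N : ℝ) ^ (1 - β) * (c * (N : ℝ) ^ (-(3 / 2 : ℝ))) ^ (-(β / 2)) :=
          mul_le_mul h1 h2 (by positivity) (by positivity)
      _ = c ^ (-(β / 2)) * (N : ℝ) ^ (1 - β / 4) := by
          rw [Real.mul_rpow hc0.le (by positivity), ← Real.rpow_mul hN0.le]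
          have : (N : ℝ) ^ (1 - β) * (N : ℝ) ^ (-(3 / 2 : ℝ) * -(β / 2)) = (N : ℝ) ^ (1 - β / 4) := by
            rw [← Real.rpow_add hN0]; congr 1; ring
          rw [← this]; ring
      _ ≤ c ^ (-(β / 2)) * (N : ℝ) ^ (1 - δ) := by
          apply mul_le_mul_of_nonneg_left _ (by positivity)
          apply Real.rpow_le_rpow_of_exponent_le hN1
          have : δ ≤ β / 4 := min_le_right _ _
          linarith
  calc C * (L * lam ^ α + L ^ (1 - β) * lam ^ (-(β / 2)))
      ≤ C * (c ^ α * (N : ℝ) ^ (1 - δ) + c ^ (-(β / 2)) * (N : ℝ) ^ (1 - δ)) := by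
        apply mul_le_mul_of_nonneg_left (add_le_add hT1 hT2) (by linarith)
    _ = C * (c ^ α + c ^ (-(β / 2))) * (N : ℝ) ^ (1 - δ) := by ring

/-- **Power saving for the shifted sums `∑_{N<n≤x} (n + w)^{-iu}`, `√N ≤ u ≤ N^{K + 1/2}`,
`0 ≤ w ≤ 1`** (all `k`-th derivative tests, `2 ≤ k ≤ K + 1`; as `powerSaving`). [folklore] -/
theorem powerSaving_shift (K : ℕ) (hK : 1 ≤ K) :
    ∃ C δ : ℝ, 0 < δ ∧ 0 ≤ C ∧ ∀ N : ℕ, 1 ≤ N → ∀ u : ℝ,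
      (N : ℝ) ^ (1 / 2 : ℝ) ≤ u → u ≤ (N : ℝ) ^ ((K : ℝ) + 1 / 2) →
      ∀ w : ℝ, 0 ≤ w → w ≤ 1 → ∀ x : ℕ, N < x → x ≤ 2 * N →
        ‖∑ n ∈ Finset.Ioc (N : ℤ) x, e (phaseD u 0 ((n : ℝ) + w))‖ ≤ C * (N : ℝ) ^ (1 - δ) := by
  induction K, hK using Nat.le_induction with
  | base =>
    obtain ⟨C, δ, hδ, hC, h⟩ := powerSaving_shift_k 2 le_rfl
    refine ⟨C, δ, hδ, hC, fun N hN u hu1 hu2 w hw0 hw1 x hx1 hx2 => h N hN u ?_ ?_ w hw0 hw1 x hx1 hx2⟩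
    · convert hu1 using 2; norm_num
    · convert hu2 using 2; norm_num
  | succ K hK ih =>
    obtain ⟨C₁, δ₁, hδ₁, hC₁, h₁⟩ := ih
    obtain ⟨C₂, δ₂, hδ₂, hC₂, h₂⟩ := powerSaving_shift_k (K + 2) (by omega)
    refine ⟨max C₁ C₂, min δ₁ δ₂, lt_min hδ₁ hδ₂, le_max_of_le_left hC₁, ?_⟩
    intro N hN u hu1 hu2 w hw0 hw1 x hx1 hx2
    have hN1 : (1 : ℝ) ≤ N := by exact_mod_cast hN
    have hmono : ∀ {C' δ' : ℝ}, C' ≤ max C₁ C₂ → min δ₁ δ₂ ≤ δ' → 0 ≤ C' →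
        C' * (N : ℝ) ^ (1 - δ') ≤ max C₁ C₂ * (N : ℝ) ^ (1 - min δ₁ δ₂) := by
      intro C' δ' hC' hδ' hC'0
      apply mul_le_mul hC' _ (by positivity) (le_trans hC'0 hC')
      exact Real.rpow_le_rpow_of_exponent_le hN1 (by linarith)
    rcases le_or_gt u ((N : ℝ) ^ ((K : ℝ) + 1 / 2)) with hu | hu
    · exact (h₁ N hN u hu1 hu w hw0 hw1 x hx1 hx2).trans
        (hmono (le_max_left _ _) (min_le_left _ _) hC₁)
    · refine (h₂ N hN u ?_ ?_ w hw0 hw1 x hx1 hx2).trans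
        (hmono (le_max_right _ _) (min_le_right _ _) hC₂)
      · refine le_trans (le_of_eq ?_) hu.le
        congr 1; push_cast; ring
      · refine hu2.trans (le_of_eq ?_)
        congr 1; push_cast; ring

end VdC

open Complex

/-- **Vinogradov's estimate in its natural range** `N^{K + 1/2} ≤ t` (i.e. `λ = log t/log N ≥ K + 1/2`),
with constants `(C, c)`: `‖∑_{N < n ≤ R} (n + u)^{-it}‖ ≤ C N^{1 − c (log N)²/(log t)²}` for
`1 ≤ N < R ≤ 2N`, `0 < u ≤ 1` (Ford's Theorem 2 restricted to `λ ≥ K + 1/2`; Titchmarsh (6.19.1),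
after Walfisz, is the case `K = 18`, `c = 1/240000`, for `u → 0⁺`).  A predicate in `(K, C, c)`, not a
named fact. [cite: Ford2002, Theorem 2] [cite: Titchmarsh1986, §6.19 (6.19.1)] -/
def VinogradovRangeBound (K : ℕ) (C c : ℝ) : Prop :=
  ∀ (N R : ℕ) (t u : ℝ), 1 ≤ N → (N : ℝ) ^ ((K : ℝ) + 1 / 2) ≤ t → 0 < u → u ≤ 1 → N < R →
    R ≤ 2 * N →
      ‖∑ n ∈ Finset.Ioc N R, ((n : ℂ) + u) ^ (-(t * I))‖ ≤
        C * (N : ℝ) ^ (1 - c * Real.log N ^ 2 / Real.log t ^ 2)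

/-- **The small-`λ` range is van der Corput's**: `VinogradovRangeBound K C c ⟹ ExpSumBound C' D`
with `C' = max(C, C₁)`, `D = max(1/δ, 1/c)`, where `(C₁, δ)` is the power saving of
`VdC.powerSaving_shift K` for `√N ≤ t ≤ N^{K + 1/2}` (there `N^{1−δ} ≤ N^{1 − (log N)²/(D log² t)}`
as `log N ≤ log t`). [folklore] -/
theorem expSumBound_of_vinogradovRange {K : ℕ} (hK : 1 ≤ K) {C c : ℝ} (hC : 0 ≤ C) (hc : 0 < c)
    (h : VinogradovRangeBound K C c) : ∃ C' D : ℝ, 0 ≤ C' ∧ 0 < D ∧ ExpSumBound C' D := by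
  obtain ⟨C₁, δ, hδ, hC₁, hps⟩ := VdC.powerSaving_shift K hK
  set D : ℝ := max (1 / δ) (1 / c) with hDdef
  have hD0 : 0 < D := lt_max_of_lt_left (by positivity)
  have hDδ : 1 / D ≤ δ := by
    rw [one_div_le hD0 hδ]; exact le_max_left _ _
  have hDc : 1 / D ≤ c := by
    rw [one_div_le hD0 hc]; exact le_max_right _ _
  refine ⟨max C C₁, D, le_max_of_le_left hC, hD0, ?_⟩
  intro N R t u hN hNt hu0 hu1 hNR hR2
  have hN1 : (1 : ℝ) ≤ N := by exact_mod_cast hN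
  have hN0 : (0 : ℝ) < N := by linarith
  have ht1 : 1 ≤ t := hN1.trans hNt
  have hlogN : 0 ≤ Real.log N := Real.log_nonneg hN1
  have hlogt : 0 ≤ Real.log t := Real.log_nonneg ht1
  have hlogNt : Real.log N ≤ Real.log t := Real.log_le_log hN0 hNt
  have hC' : 0 ≤ max C C₁ := le_max_of_le_left hC
  -- the two exponents against `E = (log N)²/(D log² t) ∈ [0, 1/D]`
  set E : ℝ := Real.log N ^ 2 / (D * Real.log t ^ 2) with hEdef
  have hE' : E = 1 / D * (Real.log N ^ 2 / Real.log t ^ 2) := by rw [hEdef]; ring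
  have hsq : Real.log N ^ 2 ≤ Real.log t ^ 2 := pow_le_pow_left₀ hlogN hlogNt 2
  have hr0 : 0 ≤ Real.log N ^ 2 / Real.log t ^ 2 := by positivity
  have hr1 : Real.log N ^ 2 / Real.log t ^ 2 ≤ 1 := div_le_one_of_le₀ hsq (by positivity)
  have hE1 : E ≤ 1 / D ∧ E ≤ c * Real.log N ^ 2 / Real.log t ^ 2 := by
    constructor
    · calc E = 1 / D * (Real.log N ^ 2 / Real.log t ^ 2) := hE'
        _ ≤ 1 / D * 1 := by gcongr
        _ = 1 / D := mul_one _
    · calc E = 1 / D * (Real.log N ^ 2 / Real.log t ^ 2) := hE'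
        _ ≤ c * (Real.log N ^ 2 / Real.log t ^ 2) := mul_le_mul_of_nonneg_right hDc hr0
        _ = c * Real.log N ^ 2 / Real.log t ^ 2 := by ring
  rcases le_or_gt ((N : ℝ) ^ ((K : ℝ) + 1 / 2)) t with hV | hS
  · -- Vinogradov's range
    refine (h N R t u hN hV hu0 hu1 hNR hR2).trans ?_
    refine mul_le_mul (le_max_left _ _) ?_ (by positivity) hC'
    exact Real.rpow_le_rpow_of_exponent_le hN1 (by linarith [hE1.2])
  · -- van der Corput's range
    have hsum : ∑ n ∈ Finset.Ioc N R, ((n : ℂ) + u) ^ (-(t * I)) =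
        ∑ n ∈ Finset.Ioc (N : ℤ) R, VdC.e (VdC.phaseD t 0 ((n : ℝ) + u)) := by
      rw [VdC.sum_Ioc_int_eq_nat]
      refine Finset.sum_congr rfl fun n hn ↦ ?_
      rw [Int.cast_natCast, RichertFromExpSum.e_phaseD_zero_real t (by positivity)]
      push_cast; ring_nf
    rw [hsum]
    have hsqrt : (N : ℝ) ^ (1 / 2 : ℝ) ≤ t := by
      refine le_trans ?_ hNt
      calc (N : ℝ) ^ (1 / 2 : ℝ) ≤ (N : ℝ) ^ (1 : ℝ) := Real.rpow_le_rpow_of_exponent_le hN1 (by norm_num)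
        _ = N := Real.rpow_one _
    refine (hps N hN t hsqrt hS.le u hu0.le hu1 R hNR hR2).trans ?_
    refine mul_le_mul (le_max_right _ _) ?_ (by positivity) hC'
    exact Real.rpow_le_rpow_of_exponent_le hN1 (by linarith [hE1.1])

/-- **The Vinogradov–Korobov zero-free region from Vinogradov's estimate in its natural range**:
`VinogradovRangeBound K C c` (`K ≥ 1`, `C ≥ 0`, `c > 0`) `⟹ ∃ c' > 0, HasVKZeroFreeRegion c' 21`
(`expSumBound_of_vinogradovRange`, `hasVKZeroFreeRegion_of_expSumBound`).
[cite: Ford2002, Theorem 2 and Lemma 7.3] [cite: Khale2024, (1.4) and Theorem B.1] -/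
theorem hasVKZeroFreeRegion_of_vinogradovRange {K : ℕ} (hK : 1 ≤ K) {C c : ℝ} (hC : 0 ≤ C)
    (hc : 0 < c) (h : VinogradovRangeBound K C c) : ∃ c' : ℝ, 0 < c' ∧ HasVKZeroFreeRegion c' 21 := by
  obtain ⟨C', D, hC', hD, hE⟩ := expSumBound_of_vinogradovRange hK hC hc h
  exact hasVKZeroFreeRegion_of_expSumBound hE hC' hD

end Literature.NumberTheory.LFunctions
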